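import Summits.Langlands.Langlands.Theorems.IrreducibilityBySelfDualityIrreducibleGL3CMContinuousSemisimplification
import HarnessLib

/-!
# Continuous dévissage with the change of frame recorded
(crux `IrreducibilityBySelfDuality.ReciprocityUpToIrreducibility`, item stmt-Langlands-14328, line
`Sketch`, helper file for the stub `stub_geometricConstituents`)

For a topological group `G`, a topological field `k` and a homomorphism `ψ : G → GL_n(k)` whose
representation on `kⁿ` has a proper non-zero stable subspace `W`, a basis of `kⁿ` adapted to a
decomposition `kⁿ = W ⊕ C` gives a change of frame `P ∈ GL_n(k)` for which ALL the matrices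
`P ψ(g) P⁻¹` are block upper triangular along `Fin m ⊕ Fin p ≃ Fin n` (`m = dim W`, `p = dim C`,
both positive): `exists_conj_blockTriangular_of_subrepresentation`.  This is the tree's dévissage
(`Literature.RepresentationTheory.Semisimple.exists_blocks_of_subrepresentation`, and its
continuous form `exists_continuous_blocks_of_subrepresentation` of the rank-3 crux) with the
conjugating matrix exported, which is what heredity statements about the diagonal blocks (de Rham,
unramified) consume.  The diagonal blocks of a CONTINUOUS block upper triangular homomorphism are
continuous homomorphisms (`exists_continuousHom_blocks_of_blockTriangular`: their entries and the
entries of their inverses are entries of `T(g)` and `T(g)⁻¹`, `Units.continuous_iff`), the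
characteristic polynomial is the product of those of the diagonal blocks
(`Matrix.charpoly_fromBlocks_zero₂₁`), and `T g = 1` forces the diagonal blocks to be `1`.

References: C. W. Curtis, I. Reiner, *Methods of Representation Theory* I (1981), §16B; N. Bourbaki,
*Algèbre* VIII (2012), § 20 n° 6.
-/

noncomputable section

set_option linter.dupNamespace false -- project-wide option (lakefile weak.linter.dupNamespace); `Summit.Langlands.Langlands` is the mandated namespace

open scoped MatrixGroups
open Matrix Module
open Literature.RepresentationTheory.Semisimple Literature.NumberTheory.GaloisRepresentations

namespace Summit.Langlands.Langlands.Theorems.ReciprocityUpToIrreducibility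

universe u v

section Algebraic

variable {k : Type u} [Field k] {G : Type v} [Group G]

/-- **Dévissage with the change of frame recorded.**  If the representation of `G` on `kⁿ` through
`ψ : G → GL_n(k)` has a proper non-zero subrepresentation `W`, there are `0 < m`, `0 < p`,
`e : Fin m ⊕ Fin p ≃ Fin n` and a change of frame `P ∈ GL_n(k)` such that every `P ψ(g) P⁻¹` is block
upper triangular along `e`: it is the matrix of `ψ(g)` in a basis adapted to `kⁿ = W ⊕ C`
(`basis_toMatrix_mul_linearMap_toMatrix_mul_basis_toMatrix`), reindexed along `e`, and its lower left
block vanishes because `W` is stable.  Curtis–Reiner, *Methods* I, §16B. [folklore] -/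
theorem exists_conj_blockTriangular_of_subrepresentation {n : ℕ} (ψ : G →* GL (Fin n) k)
    (W : Subrepresentation
      ((Representation.ofDistribMulAction k (GL (Fin n) k) (Fin n → k)).comp ψ))
    (hW0 : W ≠ ⊥) (hW1 : W ≠ ⊤) :
    ∃ (m p : ℕ) (_ : 0 < m) (_ : 0 < p) (e : Fin m ⊕ Fin p ≃ Fin n) (P : GL (Fin n) k),
      ∀ g, ∃ (A : Matrix (Fin m) (Fin m) k) (B : Matrix (Fin m) (Fin p) k)
        (D : Matrix (Fin p) (Fin p) k),
        ((P * ψ g * P⁻¹ : GL (Fin n) k) : Matrix (Fin n) (Fin n) k) =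
          Matrix.reindex e e (Matrix.fromBlocks A B 0 D) := by
  classical
  -- adapted from `Literature.RepresentationTheory.Semisimple.exists_blocks_of_subrepresentation`
  let R : Representation k G (Fin n → k) :=
    (Representation.ofDistribMulAction k (GL (Fin n) k) (Fin n → k)).comp ψ
  have hRapply : ∀ (g : G) (v : Fin n → k),
      R g v = ((ψ g : GL (Fin n) k) : Matrix (Fin n) (Fin n) k) *ᵥ v := fun _ _ ↦ rfl
  have hRlin : ∀ g, (R g : (Fin n → k) →ₗ[k] (Fin n → k)) =
      Matrix.toLin' ((ψ g : GL (Fin n) k) : Matrix (Fin n) (Fin n) k) := fun g ↦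
    LinearMap.ext fun v ↦ by rw [Matrix.toLin'_apply, hRapply]
  -- the stable subspace `W` and a complement `C`
  have hbot : (⊥ : Subrepresentation R).toSubmodule = ⊥ := rfl
  have htop : (⊤ : Subrepresentation R).toSubmodule = ⊤ := rfl
  have hWS0 : W.toSubmodule ≠ ⊥ := fun h ↦
    hW0 (Subrepresentation.toSubmodule_injective (h.trans hbot.symm))
  have hWS1 : W.toSubmodule ≠ ⊤ := fun h ↦
    hW1 (Subrepresentation.toSubmodule_injective (h.trans htop.symm))
  obtain ⟨C, hWC⟩ := Submodule.exists_isCompl W.toSubmodule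
  obtain ⟨m, hm⟩ : ∃ m, finrank k W.toSubmodule = m := ⟨_, rfl⟩
  obtain ⟨p, hp⟩ : ∃ p, finrank k C = p := ⟨_, rfl⟩
  have hmp : m + p = n := by
    rw [← hm, ← hp, Submodule.finrank_add_eq_of_isCompl hWC, Module.finrank_fin_fun]
  have hm0 : 0 < m := by
    refine Nat.pos_of_ne_zero fun h ↦ hWS0 ?_
    exact Submodule.finrank_eq_zero.mp (hm.trans h)
  have hp0 : 0 < p := by
    refine Nat.pos_of_ne_zero fun h ↦ hWS1 ?_
    have hC : C = ⊥ := Submodule.finrank_eq_zero.mp (hp.trans h)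
    have := hWC.sup_eq_top
    rwa [hC, sup_bot_eq] at this
  -- an adapted basis `b`, and its reindexing `b'` along `e : Fin m ⊕ Fin p ≃ Fin n`
  let bW : Module.Basis (Fin m) k W.toSubmodule := Module.finBasisOfFinrankEq k W.toSubmodule hm
  let bC : Module.Basis (Fin p) k C := Module.finBasisOfFinrankEq k C hp
  let f : (W.toSubmodule × C) ≃ₗ[k] (Fin n → k) := Submodule.prodEquivOfIsCompl W.toSubmodule C hWC
  let b : Module.Basis (Fin m ⊕ Fin p) k (Fin n → k) := (bW.prod bC).map f
  have hrepr : ∀ w : Fin n → k, w ∈ W.toSubmodule → ∀ i : Fin p, b.repr w (Sum.inr i) = 0 := by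
    intro w hw i
    have h1 : b.repr w = (bW.prod bC).repr (f.symm w) := by
      simp only [b, Module.Basis.map_repr, LinearEquiv.trans_apply]
    have h2 : f.symm w = ((⟨w, hw⟩ : W.toSubmodule), 0) :=
      Submodule.prodEquivOfIsCompl_symm_apply_left (p := W.toSubmodule) (q := C) hWC
        (⟨w, hw⟩ : W.toSubmodule)
    rw [h1, h2, Module.Basis.prod_repr_inr]
    simp
  have hb_inl : ∀ j : Fin m, (b (Sum.inl j) : Fin n → k) ∈ W.toSubmodule := by
    intro j
    have : b (Sum.inl j) = f ((bW.prod bC) (Sum.inl j)) := by simp [b]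
    rw [this, Submodule.coe_prodEquivOfIsCompl', Module.Basis.prod_apply_inl_fst,
      Module.Basis.prod_apply_inl_snd]
    simp
  let e : Fin m ⊕ Fin p ≃ Fin n := finSumFinEquiv.trans (finCongr hmp)
  let b' : Module.Basis (Fin n) k (Fin n → k) := b.reindex e
  -- the change of frame: `P = (b' → e₀)`, `P⁻¹ = (e₀ → b')`
  let e₀ : Module.Basis (Fin n) k (Fin n → k) := Pi.basisFun k (Fin n)
  let Pm : Matrix (Fin n) (Fin n) k := b'.toMatrix e₀
  let Qm : Matrix (Fin n) (Fin n) k := e₀.toMatrix b'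
  have hPQ : Pm * Qm = 1 := Module.Basis.toMatrix_mul_toMatrix_flip _ _
  have hQP : Qm * Pm = 1 := Module.Basis.toMatrix_mul_toMatrix_flip _ _
  let P : GL (Fin n) k := ⟨Pm, Qm, hPQ, hQP⟩
  refine ⟨m, p, hm0, hp0, e, P, fun g ↦ ?_⟩
  -- the matrix of `ψ g` in the adapted basis and its blocks
  let M : Matrix (Fin m ⊕ Fin p) (Fin m ⊕ Fin p) k := LinearMap.toMatrix b b (R g)
  have h21 : M.toBlocks₂₁ = 0 := by
    ext i j
    change LinearMap.toMatrix b b (R g) (Sum.inr i) (Sum.inl j) = 0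
    rw [LinearMap.toMatrix_apply]
    exact hrepr _ (W.apply_mem_toSubmodule g (hb_inl j)) i
  have hblock : M = Matrix.fromBlocks M.toBlocks₁₁ M.toBlocks₁₂ 0 M.toBlocks₂₂ := by
    conv_lhs => rw [← Matrix.fromBlocks_toBlocks M, h21]
  refine ⟨M.toBlocks₁₁, M.toBlocks₁₂, M.toBlocks₂₂, ?_⟩
  -- `P ψ(g) P⁻¹` is the matrix of `ψ g` in the basis `b'`, i.e. `M` reindexed along `e`
  have h1 : LinearMap.toMatrix e₀ e₀ (R g : (Fin n → k) →ₗ[k] (Fin n → k)) =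
      ((ψ g : GL (Fin n) k) : Matrix (Fin n) (Fin n) k) := by
    rw [hRlin, show LinearMap.toMatrix e₀ e₀ = LinearMap.toMatrix' from
      LinearMap.toMatrix_eq_toMatrix', LinearMap.toMatrix'_toLin']
  have h2 : ((P * ψ g * P⁻¹ : GL (Fin n) k) : Matrix (Fin n) (Fin n) k) =
      LinearMap.toMatrix b' b' (R g) := by
    change Pm * ((ψ g : GL (Fin n) k) : Matrix (Fin n) (Fin n) k) * Qm = _
    simp only [Pm, Qm]
    rw [← h1, basis_toMatrix_mul_linearMap_toMatrix_mul_basis_toMatrix]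
  have h3 : LinearMap.toMatrix b' b' (R g) = Matrix.reindex e e M := by
    ext i j
    simp only [b', M, LinearMap.toMatrix_apply, Module.Basis.repr_reindex_apply,
      Module.Basis.reindex_apply, Matrix.reindex_apply, Matrix.submatrix_apply]
  rw [h2, h3]
  exact congrArg _ hblock

end Algebraic

section Topological

variable {k : Type u} [Field k] [TopologicalSpace k] [IsTopologicalRing k]
  {G : Type v} [Group G] [TopologicalSpace G]

omit [IsTopologicalRing k] in
/-- **The diagonal blocks of a continuous block upper triangular homomorphism are continuous
homomorphisms.**  If `T : G →ₜ* GL_n(k)` satisfies `T(g) = e·(A g, B g; 0, D g)·e⁻¹` for matrix valued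
functions `A`, `B`, `D`, then `A` and `D` are multiplicative (`Matrix.fromBlocks_multiply`), unital,
and continuous together with `g ↦ A(g⁻¹) = A(g)⁻¹` (their entries are entries of `T(g)`, `T(g)⁻¹`), hence
continuous homomorphisms into `GL_m(k)`, `GL_p(k)` for the units topology (`Units.continuous_iff`).
[folklore] -/
theorem exists_continuousHom_blocks_of_blockTriangular {m p n : ℕ} (e : Fin m ⊕ Fin p ≃ Fin n)
    (T : G →ₜ* GL (Fin n) k) (A : G → Matrix (Fin m) (Fin m) k) (B : G → Matrix (Fin m) (Fin p) k)
    (D : G → Matrix (Fin p) (Fin p) k)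
    (hT : ∀ g, ((T g : GL (Fin n) k) : Matrix (Fin n) (Fin n) k) =
      Matrix.reindex e e (Matrix.fromBlocks (A g) (B g) 0 (D g))) :
    ∃ (A' : G →ₜ* GL (Fin m) k) (D' : G →ₜ* GL (Fin p) k), ∀ g,
      ((A' g : GL (Fin m) k) : Matrix (Fin m) (Fin m) k) = A g ∧
        ((D' g : GL (Fin p) k) : Matrix (Fin p) (Fin p) k) = D g := by
  -- adapted from `exists_continuous_blocks_of_subrepresentation` (rank-3 crux)
  have hmul : ∀ g h, A (g * h) = A g * A h ∧ D (g * h) = D g * D h := by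
    intro g h
    have e1 : Matrix.reindex e e (Matrix.fromBlocks (A (g * h)) (B (g * h)) 0 (D (g * h))) =
        Matrix.reindex e e
          (Matrix.fromBlocks (A g) (B g) 0 (D g) * Matrix.fromBlocks (A h) (B h) 0 (D h)) := by
      rw [← hT, map_mul, Units.val_mul, hT, hT]
      simp only [Matrix.reindex_apply, Matrix.submatrix_mul_equiv]
    have e2 := (Matrix.reindex e e).injective e1
    rw [Matrix.fromBlocks_multiply] at e2
    obtain ⟨hA, -, -, hD⟩ := Matrix.fromBlocks_inj.mp e2
    refine ⟨?_, ?_⟩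
    · rw [hA, Matrix.mul_zero, add_zero]
    · rw [hD, Matrix.zero_mul, zero_add]
  have hone : A 1 = 1 ∧ D 1 = 1 := by
    have e1 : Matrix.reindex e e (Matrix.fromBlocks (A 1) (B 1) 0 (D 1)) =
        Matrix.reindex e e 1 := by
      rw [← hT, map_one, Units.val_one, Matrix.reindex_apply, Matrix.submatrix_one_equiv]
    have e2 := (Matrix.reindex e e).injective e1
    rw [← Matrix.fromBlocks_one] at e2
    obtain ⟨hA, -, -, hD⟩ := Matrix.fromBlocks_inj.mp e2
    exact ⟨hA, hD⟩
  -- continuity of the blocks and of their inverses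
  have hTc : Continuous fun g ↦ ((T g : GL (Fin n) k) : Matrix (Fin n) (Fin n) k) :=
    Units.continuous_val.comp T.continuous_toFun
  have hTci : Continuous fun g ↦ (((T g)⁻¹ : GL (Fin n) k) : Matrix (Fin n) (Fin n) k) :=
    Units.continuous_coe_inv.comp T.continuous_toFun
  have hAentry : ∀ g i j, A g i j =
      ((T g : GL (Fin n) k) : Matrix (Fin n) (Fin n) k) (e (Sum.inl i)) (e (Sum.inl j)) := by
    intro g i j
    rw [hT g, Matrix.reindex_apply, Matrix.submatrix_apply, Equiv.symm_apply_apply,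
      Equiv.symm_apply_apply, Matrix.fromBlocks_apply₁₁]
  have hDentry : ∀ g i j, D g i j =
      ((T g : GL (Fin n) k) : Matrix (Fin n) (Fin n) k) (e (Sum.inr i)) (e (Sum.inr j)) := by
    intro g i j
    rw [hT g, Matrix.reindex_apply, Matrix.submatrix_apply, Equiv.symm_apply_apply,
      Equiv.symm_apply_apply, Matrix.fromBlocks_apply₂₂]
  have hinv : ∀ g, ((T g⁻¹ : GL (Fin n) k) : Matrix (Fin n) (Fin n) k) =
      (((T g)⁻¹ : GL (Fin n) k) : Matrix (Fin n) (Fin n) k) := fun g ↦ by rw [map_inv]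
  have hAc : Continuous A := continuous_matrix fun i j ↦ by
    simp only [hAentry]
    exact hTc.matrix_elem _ _
  have hDc : Continuous D := continuous_matrix fun i j ↦ by
    simp only [hDentry]
    exact hTc.matrix_elem _ _
  have hAci : Continuous fun g ↦ A g⁻¹ := continuous_matrix fun i j ↦ by
    simp only [hAentry, hinv]
    exact hTci.matrix_elem _ _
  have hDci : Continuous fun g ↦ D g⁻¹ := continuous_matrix fun i j ↦ by
    simp only [hDentry, hinv]
    exact hTci.matrix_elem _ _
  -- as continuous homomorphisms into `GL`
  let A' : G →ₜ* GL (Fin m) k :=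
    { toFun := fun g ↦ ⟨A g, A g⁻¹, by rw [← (hmul _ _).1, mul_inv_cancel, hone.1],
        by rw [← (hmul _ _).1, inv_mul_cancel, hone.1]⟩
      map_one' := Units.ext hone.1
      map_mul' := fun g h ↦ Units.ext (hmul g h).1
      continuous_toFun := Units.continuous_iff.2 ⟨hAc, hAci⟩ }
  let D' : G →ₜ* GL (Fin p) k :=
    { toFun := fun g ↦ ⟨D g, D g⁻¹, by rw [← (hmul _ _).2, mul_inv_cancel, hone.2],
        by rw [← (hmul _ _).2, inv_mul_cancel, hone.2]⟩
      map_one' := Units.ext hone.2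
      map_mul' := fun g h ↦ Units.ext (hmul g h).2
      continuous_toFun := Units.continuous_iff.2 ⟨hDc, hDci⟩ }
  exact ⟨A', D', fun g ↦ ⟨rfl, rfl⟩⟩

/-- **Continuous dévissage with the change of frame recorded.**  A framed continuous representation
`ψ : G →ₜ* GL_n(k)` with a proper non-zero subrepresentation `W` of `kⁿ` is conjugate, by some
`P ∈ GL_n(k)` (`FramedRep.conj P ψ = P ψ P⁻¹`), to a block upper triangular one with CONTINUOUS diagonal
blocks `A : G →ₜ* GL_m(k)`, `D : G →ₜ* GL_p(k)` of positive ranks `m, p < n`.  Curtis–Reiner, *Methods* I,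
§16B. [folklore] -/
theorem exists_conj_continuous_blocks_of_subrepresentation {n : ℕ} (ψ : G →ₜ* GL (Fin n) k)
    (W : Subrepresentation
      ((Representation.ofDistribMulAction k (GL (Fin n) k) (Fin n → k)).comp ψ.toMonoidHom))
    (hW0 : W ≠ ⊥) (hW1 : W ≠ ⊤) :
    ∃ (m p : ℕ) (_ : 0 < m) (_ : 0 < p) (_ : m < n) (_ : p < n) (e : Fin m ⊕ Fin p ≃ Fin n)
      (P : GL (Fin n) k) (A : G →ₜ* GL (Fin m) k) (D : G →ₜ* GL (Fin p) k),
      ∀ g, ∃ B : Matrix (Fin m) (Fin p) k,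
        ((FramedRep.conj P ψ g : GL (Fin n) k) : Matrix (Fin n) (Fin n) k) =
          Matrix.reindex e e (Matrix.fromBlocks
            ((A g : GL (Fin m) k) : Matrix (Fin m) (Fin m) k) B 0
            ((D g : GL (Fin p) k) : Matrix (Fin p) (Fin p) k)) := by
  obtain ⟨m, p, hm0, hp0, e, P, hP⟩ :=
    exists_conj_blockTriangular_of_subrepresentation ψ.toMonoidHom W hW0 hW1
  choose A B D hABD using hP
  have hmp : m + p = n := by simpa using Fintype.card_congr e
  obtain ⟨A', D', hA'D'⟩ :=
    exists_continuousHom_blocks_of_blockTriangular (k := k) e (FramedRep.conj P ψ) A B D hABD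
  refine ⟨m, p, hm0, hp0, by omega, by omega, e, P, A', D', fun g ↦ ⟨B g, ?_⟩⟩
  rw [(hA'D' g).1, (hA'D' g).2]
  exact hABD g

/-! ### Consequences of a block upper triangular form -/

omit [IsTopologicalRing k] in
/-- The characteristic polynomial of a block upper triangular framed representation is the product
of those of its diagonal blocks (`Matrix.charpoly_fromBlocks_zero₂₁`, `Matrix.charpoly_reindex`).
[folklore] -/
theorem charpoly_eq_mul_of_blockTriangular {m p n : ℕ} (e : Fin m ⊕ Fin p ≃ Fin n)
    (T : FramedRep G k n) (A : FramedRep G k m) (D : FramedRep G k p)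
    (hT : ∀ g, ∃ B : Matrix (Fin m) (Fin p) k,
      ((T g : GL (Fin n) k) : Matrix (Fin n) (Fin n) k) =
        Matrix.reindex e e (Matrix.fromBlocks
          ((A g : GL (Fin m) k) : Matrix (Fin m) (Fin m) k) B 0
          ((D g : GL (Fin p) k) : Matrix (Fin p) (Fin p) k)))
    (g : G) : T.charpoly g = A.charpoly g * D.charpoly g := by
  obtain ⟨B, hB⟩ := hT g
  simp only [FramedRep.charpoly]
  rw [hB, Matrix.charpoly_reindex, Matrix.charpoly_fromBlocks_zero₂₁]

omit [IsTopologicalRing k] in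
/-- Where a block upper triangular framed representation is trivial, so are its diagonal blocks.
[folklore] -/
theorem eq_one_of_blockTriangular {m p n : ℕ} (e : Fin m ⊕ Fin p ≃ Fin n)
    (T : FramedRep G k n) (A : FramedRep G k m) (D : FramedRep G k p)
    (hT : ∀ g, ∃ B : Matrix (Fin m) (Fin p) k,
      ((T g : GL (Fin n) k) : Matrix (Fin n) (Fin n) k) =
        Matrix.reindex e e (Matrix.fromBlocks
          ((A g : GL (Fin m) k) : Matrix (Fin m) (Fin m) k) B 0
          ((D g : GL (Fin p) k) : Matrix (Fin p) (Fin p) k)))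
    {g : G} (hg : T g = 1) : A g = 1 ∧ D g = 1 := by
  obtain ⟨B, hB⟩ := hT g
  rw [hg, Units.val_one] at hB
  have h1 : Matrix.reindex e e (Matrix.fromBlocks
      ((A g : GL (Fin m) k) : Matrix (Fin m) (Fin m) k) B 0
      ((D g : GL (Fin p) k) : Matrix (Fin p) (Fin p) k)) = Matrix.reindex e e 1 := by
    rw [← hB, Matrix.reindex_apply, Matrix.submatrix_one_equiv]
  have h2 := (Matrix.reindex e e).injective h1
  rw [← Matrix.fromBlocks_one] at h2
  obtain ⟨hA, -, -, hD⟩ := Matrix.fromBlocks_inj.mp h2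
  exact ⟨Units.ext hA, Units.ext hD⟩

/-- Iterated change of frame: `conj Q (conj P ρ) = conj (Q * P) ρ`. [folklore] -/
theorem conj_conj_eq_conj_mul {n : ℕ} (P Q : GL (Fin n) k) (ρ : FramedRep G k n) :
    FramedRep.conj Q (FramedRep.conj P ρ) = FramedRep.conj (Q * P) ρ := by
  ext g : 1
  simp only [FramedRep.conj_apply, _root_.mul_inv_rev]
  group

/-- Conjugate framed representations have the same characteristic polynomials
(`Matrix.charpoly_units_conj`). [folklore] -/
theorem charpoly_conj_eq {n : ℕ} (P : GL (Fin n) k) (ρ : FramedRep G k n) (g : G) :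
    FramedRep.charpoly (FramedRep.conj P ρ) g = FramedRep.charpoly ρ g := by
  simp only [FramedRep.charpoly, FramedRep.conj_apply, Units.val_mul, Matrix.coe_units_inv]
  exact Matrix.charpoly_units_conj P _

/-- `ρ g = 1 → conj P ρ g = 1`. [folklore] -/
theorem conj_apply_eq_one {n : ℕ} (P : GL (Fin n) k) (ρ : FramedRep G k n) {g : G}
    (hg : ρ g = 1) : FramedRep.conj P ρ g = 1 := by
  rw [FramedRep.conj_apply, hg, mul_one, mul_inv_cancel]

end Topological

/-! ### The Galois specialisation (registered sub-goal of the stub `stub_geometricConstituents`) -/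

/-- **Continuous dévissage of a reducible framed Galois representation, with the change of frame
recorded** (`G = Γ_K`, `k = ℚ̄_ℓ` in `exists_conj_continuous_blocks_of_subrepresentation`): a proper
non-zero subrepresentation `W` of `ℚ̄_ℓⁿ` gives `P ∈ GL_n(ℚ̄_ℓ)` with `P ρ P⁻¹` block upper triangular
along some `Fin m ⊕ Fin p ≃ Fin n`, `0 < m, p < n`, with continuous diagonal blocks
`A : Γ_K →ₜ* GL_m(ℚ̄_ℓ)`, `D : Γ_K →ₜ* GL_p(ℚ̄_ℓ)`.  Curtis–Reiner, *Methods* I, §16B. [folklore] -/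
theorem exists_conj_continuous_blocks_galois : ∀ (K : Type) [Field K] (ℓ : ℕ) [Fact ℓ.Prime] (n : ℕ) (ρ : FramedGaloisRep K (PadicAlgCl ℓ) n) (W : Subrepresentation (FramedRep.toRepresentation ρ)), W ≠ ⊥ → W ≠ ⊤ → ∃ (m p : ℕ) (_ : 0 < m) (_ : 0 < p) (_ : m < n) (_ : p < n) (e : Fin m ⊕ Fin p ≃ Fin n) (P : GL (Fin n) (PadicAlgCl ℓ)) (A : FramedGaloisRep K (PadicAlgCl ℓ) m) (D : FramedGaloisRep K (PadicAlgCl ℓ) p), ∀ g, ∃ B : Matrix (Fin m) (Fin p) (PadicAlgCl ℓ), ((FramedRep.conj P ρ g : GL (Fin n) (PadicAlgCl ℓ)) : Matrix (Fin n) (Fin n) (PadicAlgCl ℓ)) = Matrix.reindex e e (Matrix.fromBlocks ((A g : GL (Fin m) (PadicAlgCl ℓ)) : Matrix (Fin m) (Fin m) (PadicAlgCl ℓ)) B 0 ((D g : GL (Fin p) (PadicAlgCl ℓ)) : Matrix (Fin p) (Fin p) (PadicAlgCl ℓ))) := by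
  intro K _ ℓ _ n ρ W hW0 hW1
  exact exists_conj_continuous_blocks_of_subrepresentation (k := PadicAlgCl ℓ) ρ W hW0 hW1

end Summit.Langlands.Langlands.Theorems.ReciprocityUpToIrreducibility

end
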